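import Summits.QuantumFields.BalabanUV.Beta.GAN24.DecimatedKernelLegs
import Summits.QuantumFields.BalabanUV.Beta.GAN24.OffDiagSandwich

/-!
# `BalabanUV.Beta.GAN24.S3DiffVLegs` — binder row G-an2-4 / (CONV-C), S-slot («E3Shape» ∧ «E3SupRate»), road S3, DIFF row **R3-dV**
# (typer `LEAVES.md` v3.3 PART III § III.R, holder `b2b-balaban-gan24-formalise-leaf-03-g15`, INTENT «ROW-dV*» journal l.5224), part 5 (`d = 3`):
# THE FIFTEEN LEG BOUNDS — the five blocks of `K = KInv (Lc^{n+2})`, of `K♮ = D·dec Lc (KInv (Lc^{n+3}))·D` and of `K♮ − K`, in the literal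
# currency of part 3's `ThreeKernelRowVBound.abs_entry3_le`, FROM the leg packages as HYPOTHESES (road P1's `Φ̃` legs, leaf-16's (N1) legs,
# the K-slot's `CauchyDecayK`, leaf-19-g15's decimated (N1-Cauchy) leg differences) — nothing instantiated here

NOT IN PRINT; OUR PROOF ATTEMPT.  HONEST FRAMING (cell contract, verbatim): «discharging `BetaPertH` makes Bałaban's UV stability
UNCONDITIONAL — a real constructive-QFT result; it is NOT the continuum limit and NOT the Clay problem.»  HONEST DEPENDENCY (verbatim):
«continuum YM on T⁴ ⇐ BetaPertH ∧ nine spine estimates (0/9 proved); BetaPertH ⇐ (D1) ∧ (D4) ∧ CAP+tail; G-an2-4 gates asym, D1 and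
NE2/3/4.»  [folklore] re-indexing of hypotheses through part 4's block identities (`DecimatedKernelLegs`), the tree's pins
`KInv_inr_inl_coarse` / `KInv_inl_inr_coarse`, `mm_coarse_eq_KStepUnit`, and the triangle inequality; the hypotheses have the LITERAL shapes of
`StencilSlotE3PhiLeg.phiLeg_three` (Φ̃), `StencilSlotE3HLeg.legs_three` (H̃, G̃), `CombesThomas.CauchyDecayK` (K-slot) and leaf-19-g15's
`FineReadoutCauchyDecLegs.decLegs_three_of_cellMean` (decimated (N1-Cauchy) differences) — all supplied BY NAME in part 6 (`GAN24/S3DiffV`).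
0 `def`, 0 cite, 0 `def … : Prop`, 0 sorry.  Discharges NOTHING by itself; NOT BetaPertH, NOT continuum, NOT Clay.

## What is proved (`d = 3`; member `n+2` at `N = Lc^{n+2}`, member `n+3` at `N′ = Lc^{n+3}`; one common rate `κ₀` below all package rates)
§1 helpers (`bound_rate_mono`, `quo_pow_succ_zsmul`, unit arithmetic).  §2 the five `K`-blocks (`legK_*`).  §3 the five `K♮`-blocks (`legKn_*`: `mm` from
`Φ̃` at member `n+3` read at `Lc•w`; mixed blocks by triangle from the `K`-block and the difference).  §4 the five `(K♮ − K)`-blocks (`legD_*`: mixed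
blocks = leaf-19's decimated differences VERBATIM after part 4's identities; `mm` blocks = `Lc^8 ×` the K-slot's one-step difference
`K̃_{n+2} − K̃_{n+1}` at `Lc`-dilated points, or `0 − 0` off the coarse lattice) — the difference constants carry `θ_K^{n+1}` / `θ′^{n+1}`.
-/

noncomputable section

open Finset
open scoped BigOperators
open Literature.MathematicalPhysics.QuantumFieldTheory
open Literature.MathematicalPhysics.QuantumFieldTheory.Balaban1983to89
open Literature.MathematicalPhysics.QuantumFieldTheory.Balaban1983to89.Beta
open Literature.Probability.LatticeModels (Torus.proj)
open LatticeForm (quo)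
open B12Sec2to5 (l1 l1_nonneg)
open ExpKernelCalculus (MKer Decays l1_sub_symm)
open KernelSpecInstance (wH)
open KKTFluctuationKernel (GamΦ)
open OneStepResolventKernel (Fib KInv quo_zsmul eq_zsmul_quo_of_proj KInv_inr_inl_coarse KInv_inl_inr_coarse)
open OneStepKernelFamily (dec legSet legW legPt)
open BalabanStepJetsSucc (l1_sub_le_l1_smul_sub)
open Summit.QuantumFields.BalabanUV.Beta.HessKerDressedUnits (unitK)
open Summit.QuantumFields.BalabanUV.Beta.GAN24.CombesThomas (KStepUnit sfStep smStep CauchyDecayK)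
open Summit.QuantumFields.BalabanUV.Beta.GAN24.ScaleNesting (quo_mul)
open Summit.QuantumFields.BalabanUV.Beta.GAN24.ThirdJetThreeKernel (mker_sub_apply')
open Summit.QuantumFields.BalabanUV.Beta.GAN24.OffDiagSandwich (const_nonneg_of_dom)
open Summit.QuantumFields.BalabanUV.Beta.GAN24.DecimatedKernelLegs

namespace Summit.QuantumFields.BalabanUV.Beta.GAN24.S3DiffVLegs

variable {Lc : ℕ} [NeZero Lc]

/-! ## §1 Helpers -/

omit [NeZero Lc] in
/-- [folklore] A bound `|v| ≤ C e^{−κ s}` weakens to rate `κ₀ ≤ κ`. -/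
theorem bound_rate_mono {v C κ κ₀ s : ℝ} (hv : |v| ≤ C * Real.exp (-κ * s)) (hC : 0 ≤ C) (h : κ₀ ≤ κ) (hs : 0 ≤ s) :
    |v| ≤ C * Real.exp (-κ₀ * s) :=
  hv.trans (mul_le_mul_of_nonneg_left (Real.exp_le_exp.2 (by nlinarith)) hC)

/-- [folklore] The next level's block label of an `Lc`-dilated site is this level's block label: `quo (Lc^{j+1}) (Lc•w) = quo (Lc^j) w`. -/
theorem quo_pow_succ_zsmul (j : ℕ) (w : Fin (3 + 1) → ℤ) : quo (Lc ^ (j + 1)) ((Lc : ℤ) • w) = quo (Lc ^ j) w := by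
  rw [pow_succ', quo_mul, quo_zsmul]

omit [NeZero Lc] in
/-- [folklore] Unit arithmetic `(Lc^{j+1})^8 · Lc^8 = (Lc^{j+2})^8`. -/
theorem pow_mm_succ (j : ℕ) : ((Lc : ℝ) ^ (j + 1)) ^ (2 * (3 + 1)) * (Lc : ℝ) ^ (2 * (3 + 1)) = ((Lc : ℝ) ^ (j + 1 + 1)) ^ (2 * (3 + 1)) := by
  rw [pow_succ (Lc : ℝ) (j + 1), mul_pow]

omit [NeZero Lc] in
/-- [folklore] Unit arithmetic `(Lc^{j+1})^5 · Lc^5 = (Lc^{j+2})^5`. -/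
theorem pow_mixed_succ (j : ℕ) : ((Lc : ℝ) ^ (j + 1)) ^ (3 + 2) * (Lc : ℝ) ^ (3 + 2) = ((Lc : ℝ) ^ (j + 1 + 1)) ^ (3 + 2) := by
  rw [pow_succ (Lc : ℝ) (j + 1), mul_pow]

/-! ## §2 The five blocks of `K = KInv (Lc^{n+2})` -/

section LegsK

variable {CΦ δΦ CH κH κ₀ : ℝ}

/-- [folklore] `K`'s `mf` row block at a coarse row argument is `G̃` (`KInv_inr_inl_coarse`). -/
theorem legK_mf (hκ : κ₀ ≤ κH)
    (hG : ∀ (j : ℕ) (α l : Fin (3 + 1)) (x' w : Fin (3 + 1) → ℤ),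
      |((Lc : ℝ) ^ (j + 1)) ^ (3 + 2) * GamΦ (N := Lc ^ (j + 1)) α x' l w| ≤ CH * Real.exp (-κH * l1 (x' - quo (Lc ^ (j + 1)) w)))
    (n : ℕ) (x' w : Fin (3 + 1) → ℤ) (α l : Fin (3 + 1)) :
    |((Lc : ℝ) ^ (n + 1 + 1)) ^ (3 + 2) *
        KInv (N := Lc ^ (n + 1 + 1)) (d := 3) (((Lc ^ (n + 1 + 1) : ℕ) : ℤ) • x') w (Sum.inr α) (Sum.inl l)| ≤
      CH * Real.exp (-κ₀ * l1 (x' - quo (Lc ^ (n + 1 + 1)) w)) := by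
  rw [KInv_inr_inl_coarse]
  exact bound_rate_mono (hG (n + 1) α l x' w) (const_nonneg_of_dom (hG 0 0 0 0 0)) hκ (l1_nonneg _)

/-- [folklore] `K`'s `fm` block at a coarse column argument is `H̃` (`KInv_inl_inr_coarse`). -/
theorem legK_fm (hκ : κ₀ ≤ κH)
    (hH : ∀ (j : ℕ) (k l : Fin (3 + 1)) (u u' : Fin (3 + 1) → ℤ),
      |((Lc : ℝ) ^ (j + 1)) ^ (3 + 2) * wH (N := Lc ^ (j + 1)) k l (u - (((Lc ^ (j + 1) : ℕ) : ℤ)) • u')| ≤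
        CH * Real.exp (-κH * l1 (quo (Lc ^ (j + 1)) u - u')))
    (n : ℕ) (k l : Fin (3 + 1)) (u u' : Fin (3 + 1) → ℤ) :
    |((Lc : ℝ) ^ (n + 1 + 1)) ^ (3 + 2) *
        KInv (N := Lc ^ (n + 1 + 1)) (d := 3) u (((Lc ^ (n + 1 + 1) : ℕ) : ℤ) • u') (Sum.inl k) (Sum.inr l)| ≤
      CH * Real.exp (-κ₀ * l1 (quo (Lc ^ (n + 1 + 1)) u - u')) := by
  rw [KInv_inl_inr_coarse]
  exact bound_rate_mono (hH (n + 1) k l u u') (const_nonneg_of_dom (hH 0 0 0 0 0)) hκ (l1_nonneg _)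

/-- [folklore] `K`'s `mm` row block (`Φ̃`, left form). -/
theorem legK_mm_left (hκ : κ₀ ≤ δΦ)
    (hΦ₁ : ∀ (j : ℕ) (x' w : Fin (3 + 1) → ℤ) (α β : Fin (3 + 1)),
      |((Lc : ℝ) ^ (j + 1)) ^ (2 * (3 + 1)) *
          KInv (N := Lc ^ (j + 1)) (d := 3) (((Lc ^ (j + 1) : ℕ) : ℤ) • x') w (Sum.inr α) (Sum.inr β)| ≤
        CΦ * Real.exp (-δΦ * l1 (x' - quo (Lc ^ (j + 1)) w)))
    (n : ℕ) (x' w : Fin (3 + 1) → ℤ) (α β : Fin (3 + 1)) :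
    |((Lc : ℝ) ^ (n + 1 + 1)) ^ (2 * (3 + 1)) *
        KInv (N := Lc ^ (n + 1 + 1)) (d := 3) (((Lc ^ (n + 1 + 1) : ℕ) : ℤ) • x') w (Sum.inr α) (Sum.inr β)| ≤
      CΦ * Real.exp (-κ₀ * l1 (x' - quo (Lc ^ (n + 1 + 1)) w)) :=
  bound_rate_mono (hΦ₁ (n + 1) x' w α β) (const_nonneg_of_dom (hΦ₁ 0 0 0 0 0)) hκ (l1_nonneg _)

/-- [folklore] `K`'s `mm` column block (`Φ̃`, right form). -/
theorem legK_mm_right (hκ : κ₀ ≤ δΦ)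
    (hΦ₂ : ∀ (j : ℕ) (y z' : Fin (3 + 1) → ℤ) (α β : Fin (3 + 1)),
      |((Lc : ℝ) ^ (j + 1)) ^ (2 * (3 + 1)) *
          KInv (N := Lc ^ (j + 1)) (d := 3) y (((Lc ^ (j + 1) : ℕ) : ℤ) • z') (Sum.inr α) (Sum.inr β)| ≤
        CΦ * Real.exp (-δΦ * l1 (quo (Lc ^ (j + 1)) y - z')))
    (n : ℕ) (y z' : Fin (3 + 1) → ℤ) (α β : Fin (3 + 1)) :
    |((Lc : ℝ) ^ (n + 1 + 1)) ^ (2 * (3 + 1)) *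
        KInv (N := Lc ^ (n + 1 + 1)) (d := 3) y (((Lc ^ (n + 1 + 1) : ℕ) : ℤ) • z') (Sum.inr α) (Sum.inr β)| ≤
      CΦ * Real.exp (-κ₀ * l1 (quo (Lc ^ (n + 1 + 1)) y - z')) :=
  bound_rate_mono (hΦ₂ (n + 1) y z' α β) (const_nonneg_of_dom (hΦ₂ 0 0 0 0 0)) hκ (l1_nonneg _)

end LegsK

/-! ## §3–§4 The blocks of `K♮ = D·dec Lc (KInv (Lc^{n+3}))·D` and of `K♮ − K` -/

section LegsKn

variable {CΦ δΦ CH κH cK θK δK c' θ' κ' κ₀ : ℝ}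

omit [NeZero Lc] in
/-- [folklore] The dilated blocking: `Lc^{n+3} = Lc · Lc^{n+2}`. -/
theorem pow3_eq (n : ℕ) : Lc ^ (n + 1 + 1 + 1) = Lc * Lc ^ (n + 1 + 1) := pow_succ' Lc (n + 1 + 1)

/-- [folklore] **`K♮`'s `mm` ROW BLOCK** is member `n+3`'s `Φ̃` leg read at `Lc•w`: bound `CΦ e^{−κ₀|x′ − quo_N w|₁}`. -/
theorem legKn_mm_left (hκ : κ₀ ≤ δΦ)
    (hΦ₁ : ∀ (j : ℕ) (x' w : Fin (3 + 1) → ℤ) (α β : Fin (3 + 1)),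
      |((Lc : ℝ) ^ (j + 1)) ^ (2 * (3 + 1)) *
          KInv (N := Lc ^ (j + 1)) (d := 3) (((Lc ^ (j + 1) : ℕ) : ℤ) • x') w (Sum.inr α) (Sum.inr β)| ≤
        CΦ * Real.exp (-δΦ * l1 (x' - quo (Lc ^ (j + 1)) w)))
    (n : ℕ) (x' w : Fin (3 + 1) → ℤ) (α β : Fin (3 + 1)) :
    |((Lc : ℝ) ^ (n + 1 + 1)) ^ (2 * (3 + 1)) *
        unitK (Lc : ℝ) ((Lc : ℝ) ^ (3 + 1)) (dec Lc (KInv (N := Lc ^ (n + 1 + 1 + 1)) (d := 3)))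
          (((Lc ^ (n + 1 + 1) : ℕ) : ℤ) • x') w (Sum.inr α) (Sum.inr β)| ≤
      CΦ * Real.exp (-κ₀ * l1 (x' - quo (Lc ^ (n + 1 + 1)) w)) := by
  rw [unitK_dec_mm_coarse_left (d := 3) (pow3_eq n), ← mul_assoc, pow_mm_succ]
  have h := hΦ₁ (n + 1 + 1) x' ((Lc : ℤ) • w) α β
  rw [quo_pow_succ_zsmul] at h
  exact bound_rate_mono h (const_nonneg_of_dom (hΦ₁ 0 0 0 0 0)) hκ (l1_nonneg _)

/-- [folklore] **`K♮`'s `mm` COLUMN BLOCK** (right form, read at `Lc•y`). -/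
theorem legKn_mm_right (hκ : κ₀ ≤ δΦ)
    (hΦ₂ : ∀ (j : ℕ) (y z' : Fin (3 + 1) → ℤ) (α β : Fin (3 + 1)),
      |((Lc : ℝ) ^ (j + 1)) ^ (2 * (3 + 1)) *
          KInv (N := Lc ^ (j + 1)) (d := 3) y (((Lc ^ (j + 1) : ℕ) : ℤ) • z') (Sum.inr α) (Sum.inr β)| ≤
        CΦ * Real.exp (-δΦ * l1 (quo (Lc ^ (j + 1)) y - z')))
    (n : ℕ) (y z' : Fin (3 + 1) → ℤ) (α β : Fin (3 + 1)) :
    |((Lc : ℝ) ^ (n + 1 + 1)) ^ (2 * (3 + 1)) *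
        unitK (Lc : ℝ) ((Lc : ℝ) ^ (3 + 1)) (dec Lc (KInv (N := Lc ^ (n + 1 + 1 + 1)) (d := 3)))
          y (((Lc ^ (n + 1 + 1) : ℕ) : ℤ) • z') (Sum.inr α) (Sum.inr β)| ≤
      CΦ * Real.exp (-κ₀ * l1 (quo (Lc ^ (n + 1 + 1)) y - z')) := by
  rw [unitK_dec_mm_coarse_right (d := 3) (pow3_eq n), ← mul_assoc, pow_mm_succ]
  have h := hΦ₂ (n + 1 + 1) ((Lc : ℤ) • y) z' α β
  rw [quo_pow_succ_zsmul] at h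
  exact bound_rate_mono h (const_nonneg_of_dom (hΦ₂ 0 0 0 0 0)) hκ (l1_nonneg _)

/-- [folklore] **`K♮`'s `fm` BLOCK IN `N`-UNITS IS THE `Lc`-BLOCK-CONTOUR MEAN OF MEMBER `n+3`'s `H̃`** (part 4's `unitK_dec_fm_coarse` + units). -/
theorem Kn_fm_eq (n : ℕ) (k l : Fin (3 + 1)) (u u' : Fin (3 + 1) → ℤ) :
    ((Lc : ℝ) ^ (n + 1 + 1)) ^ (3 + 2) *
        unitK (Lc : ℝ) ((Lc : ℝ) ^ (3 + 1)) (dec Lc (KInv (N := Lc ^ (n + 1 + 1 + 1)) (d := 3)))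
          u (((Lc ^ (n + 1 + 1) : ℕ) : ℤ) • u') (Sum.inl k) (Sum.inr l) =
      ∑ i ∈ legSet 3 Lc (Sum.inl k), legW 3 Lc (Sum.inl k) *
        (((Lc : ℝ) ^ (n + 1 + 1 + 1)) ^ (3 + 2) *
          wH (N := Lc ^ (n + 1 + 1 + 1)) k l (legPt Lc (Sum.inl k) u i - (((Lc ^ (n + 1 + 1 + 1) : ℕ) : ℤ)) • u')) := by
  rw [unitK_dec_fm_coarse (d := 3) (pow3_eq n), ← mul_assoc, pow_mixed_succ, Finset.mul_sum]
  exact Finset.sum_congr rfl fun i _ => by ring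

/-- [folklore] **`K♮`'s `mf` ROW BLOCK IN `N`-UNITS IS THE `Lc`-BLOCK-CONTOUR MEAN OF MEMBER `n+3`'s `G̃`** (part 4's `unitK_dec_mf_coarse` + units). -/
theorem Kn_mf_eq (n : ℕ) (α l : Fin (3 + 1)) (x' w : Fin (3 + 1) → ℤ) :
    ((Lc : ℝ) ^ (n + 1 + 1)) ^ (3 + 2) *
        unitK (Lc : ℝ) ((Lc : ℝ) ^ (3 + 1)) (dec Lc (KInv (N := Lc ^ (n + 1 + 1 + 1)) (d := 3)))
          (((Lc ^ (n + 1 + 1) : ℕ) : ℤ) • x') w (Sum.inr α) (Sum.inl l) =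
      ∑ i ∈ legSet 3 Lc (Sum.inl l), legW 3 Lc (Sum.inl l) *
        (((Lc : ℝ) ^ (n + 1 + 1 + 1)) ^ (3 + 2) * GamΦ (N := Lc ^ (n + 1 + 1 + 1)) α x' l (legPt Lc (Sum.inl l) w i)) := by
  rw [unitK_dec_mf_coarse (d := 3) (pow3_eq n), ← mul_assoc, pow_mixed_succ, Finset.mul_sum]
  exact Finset.sum_congr rfl fun i _ => by ring

/-- [folklore] **THE `fm` DIFFERENCE BLOCK `(K♮ − K)_{fm}` IS leaf-19's DECIMATED `H̃`-LEG DIFFERENCE** (vertex and column legs): bound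
`c′ θ′^{n+1} e^{−κ₀|quo_N u − u′|₁}`. -/
theorem legD_fm (hκ : κ₀ ≤ κ')
    (hDH : ∀ (n : ℕ) (k l : Fin (3 + 1)) (u u' : Fin (3 + 1) → ℤ),
      |∑ i ∈ legSet 3 Lc (Sum.inl k), legW 3 Lc (Sum.inl k) *
            (((Lc : ℝ) ^ (n + 1 + 1 + 1)) ^ (3 + 2) *
              wH (N := Lc ^ (n + 1 + 1 + 1)) k l (legPt Lc (Sum.inl k) u i - (((Lc ^ (n + 1 + 1 + 1) : ℕ) : ℤ)) • u')) -
          ((Lc : ℝ) ^ (n + 1 + 1)) ^ (3 + 2) * wH (N := Lc ^ (n + 1 + 1)) k l (u - (((Lc ^ (n + 1 + 1) : ℕ) : ℤ)) • u')|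
        ≤ c' * θ' ^ (n + 1) * Real.exp (-κ' * l1 (quo (Lc ^ (n + 1 + 1)) u - u')))
    (n : ℕ) (k l : Fin (3 + 1)) (u u' : Fin (3 + 1) → ℤ) :
    |((Lc : ℝ) ^ (n + 1 + 1)) ^ (3 + 2) *
        (unitK (Lc : ℝ) ((Lc : ℝ) ^ (3 + 1)) (dec Lc (KInv (N := Lc ^ (n + 1 + 1 + 1)) (d := 3))) -
          KInv (N := Lc ^ (n + 1 + 1)) (d := 3)) u (((Lc ^ (n + 1 + 1) : ℕ) : ℤ) • u') (Sum.inl k) (Sum.inr l)| ≤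
      c' * θ' ^ (n + 1) * Real.exp (-κ₀ * l1 (quo (Lc ^ (n + 1 + 1)) u - u')) := by
  have hc' : 0 ≤ c' * θ' ^ (n + 1) := by
    have h0 := hDH n 0 0 0 0
    exact nonneg_of_mul_nonneg_left ((abs_nonneg _).trans h0) (Real.exp_pos _)
  rw [mker_sub_apply', mul_sub, Kn_fm_eq, KInv_inl_inr_coarse]
  exact bound_rate_mono (hDH n k l u u') hc' hκ (l1_nonneg _)

/-- [folklore] **THE `mf` DIFFERENCE BLOCK `(K♮ − K)_{mf}` IS leaf-19's DECIMATED `G̃`-LEG DIFFERENCE** (row leg). -/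
theorem legD_mf (hκ : κ₀ ≤ κ')
    (hDG : ∀ (n : ℕ) (α l : Fin (3 + 1)) (x' w : Fin (3 + 1) → ℤ),
      |∑ i ∈ legSet 3 Lc (Sum.inl l), legW 3 Lc (Sum.inl l) *
            (((Lc : ℝ) ^ (n + 1 + 1 + 1)) ^ (3 + 2) * GamΦ (N := Lc ^ (n + 1 + 1 + 1)) α x' l (legPt Lc (Sum.inl l) w i)) -
          ((Lc : ℝ) ^ (n + 1 + 1)) ^ (3 + 2) * GamΦ (N := Lc ^ (n + 1 + 1)) α x' l w|
        ≤ c' * θ' ^ (n + 1) * Real.exp (-κ' * l1 (x' - quo (Lc ^ (n + 1 + 1)) w)))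
    (n : ℕ) (x' w : Fin (3 + 1) → ℤ) (α l : Fin (3 + 1)) :
    |((Lc : ℝ) ^ (n + 1 + 1)) ^ (3 + 2) *
        (unitK (Lc : ℝ) ((Lc : ℝ) ^ (3 + 1)) (dec Lc (KInv (N := Lc ^ (n + 1 + 1 + 1)) (d := 3))) -
          KInv (N := Lc ^ (n + 1 + 1)) (d := 3)) (((Lc ^ (n + 1 + 1) : ℕ) : ℤ) • x') w (Sum.inr α) (Sum.inl l)| ≤
      c' * θ' ^ (n + 1) * Real.exp (-κ₀ * l1 (x' - quo (Lc ^ (n + 1 + 1)) w)) := by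
  have hc' : 0 ≤ c' * θ' ^ (n + 1) := by
    have h0 := hDG n 0 0 0 0
    exact nonneg_of_mul_nonneg_left ((abs_nonneg _).trans h0) (Real.exp_pos _)
  rw [mker_sub_apply', mul_sub, Kn_mf_eq, KInv_inr_inl_coarse]
  exact bound_rate_mono (hDG n α l x' w) hc' hκ (l1_nonneg _)

omit [NeZero Lc] in
/-- [folklore] Triangle step: `|a| ≤ |b| + |a − b|`, with `|b| ≤ B·e`, `|a − b| ≤ c·t·e`, `0 ≤ c`, `t ≤ 1`, `0 ≤ e` ⟹ `|a| ≤ (B + c)·e`. -/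
theorem abs_le_of_sub {a b B c t e : ℝ} (hb : |b| ≤ B * e) (hab : |a - b| ≤ c * t * e) (hc : 0 ≤ c) (ht1 : t ≤ 1)
    (he : 0 ≤ e) : |a| ≤ (B + c) * e := by
  have h1 : |a| ≤ |b| + |a - b| := by
    have := abs_add_le b (a - b); rwa [add_sub_cancel] at this
  have h2 : c * t * e ≤ c * e := by
    have := mul_le_mul_of_nonneg_left ht1 hc
    nlinarith
  nlinarith

/-- [folklore] **`K♮`'s `fm` BLOCK** by the triangle inequality: `|K♮_{fm}| ≤ |K_{fm}| + |(K♮ − K)_{fm}|`, constant `CH + c′` (`θ′^{n+1} ≤ 1`). -/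
theorem legKn_fm (hκH : κ₀ ≤ κH) (hκ' : κ₀ ≤ κ') (hc' : 0 ≤ c') (hθ0 : 0 ≤ θ') (hθ1 : θ' ≤ 1)
    (hH : ∀ (j : ℕ) (k l : Fin (3 + 1)) (u u' : Fin (3 + 1) → ℤ),
      |((Lc : ℝ) ^ (j + 1)) ^ (3 + 2) * wH (N := Lc ^ (j + 1)) k l (u - (((Lc ^ (j + 1) : ℕ) : ℤ)) • u')| ≤
        CH * Real.exp (-κH * l1 (quo (Lc ^ (j + 1)) u - u')))
    (hDH : ∀ (n : ℕ) (k l : Fin (3 + 1)) (u u' : Fin (3 + 1) → ℤ),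
      |∑ i ∈ legSet 3 Lc (Sum.inl k), legW 3 Lc (Sum.inl k) *
            (((Lc : ℝ) ^ (n + 1 + 1 + 1)) ^ (3 + 2) *
              wH (N := Lc ^ (n + 1 + 1 + 1)) k l (legPt Lc (Sum.inl k) u i - (((Lc ^ (n + 1 + 1 + 1) : ℕ) : ℤ)) • u')) -
          ((Lc : ℝ) ^ (n + 1 + 1)) ^ (3 + 2) * wH (N := Lc ^ (n + 1 + 1)) k l (u - (((Lc ^ (n + 1 + 1) : ℕ) : ℤ)) • u')|
        ≤ c' * θ' ^ (n + 1) * Real.exp (-κ' * l1 (quo (Lc ^ (n + 1 + 1)) u - u')))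
    (n : ℕ) (k l : Fin (3 + 1)) (u u' : Fin (3 + 1) → ℤ) :
    |((Lc : ℝ) ^ (n + 1 + 1)) ^ (3 + 2) *
        unitK (Lc : ℝ) ((Lc : ℝ) ^ (3 + 1)) (dec Lc (KInv (N := Lc ^ (n + 1 + 1 + 1)) (d := 3)))
          u (((Lc ^ (n + 1 + 1) : ℕ) : ℤ) • u') (Sum.inl k) (Sum.inr l)| ≤
      (CH + c') * Real.exp (-κ₀ * l1 (quo (Lc ^ (n + 1 + 1)) u - u')) := by
  have hK := legK_fm (Lc := Lc) hκH hH n k l u u'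
  have hD := legD_fm (Lc := Lc) hκ' hDH n k l u u'
  rw [mker_sub_apply', mul_sub] at hD
  exact abs_le_of_sub hK hD hc' (pow_le_one₀ hθ0 hθ1) (Real.exp_pos _).le

/-- [folklore] **`K♮`'s `mf` ROW BLOCK** by the triangle inequality, constant `CH + c′`. -/
theorem legKn_mf (hκH : κ₀ ≤ κH) (hκ' : κ₀ ≤ κ') (hc' : 0 ≤ c') (hθ0 : 0 ≤ θ') (hθ1 : θ' ≤ 1)
    (hG : ∀ (j : ℕ) (α l : Fin (3 + 1)) (x' w : Fin (3 + 1) → ℤ),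
      |((Lc : ℝ) ^ (j + 1)) ^ (3 + 2) * GamΦ (N := Lc ^ (j + 1)) α x' l w| ≤ CH * Real.exp (-κH * l1 (x' - quo (Lc ^ (j + 1)) w)))
    (hDG : ∀ (n : ℕ) (α l : Fin (3 + 1)) (x' w : Fin (3 + 1) → ℤ),
      |∑ i ∈ legSet 3 Lc (Sum.inl l), legW 3 Lc (Sum.inl l) *
            (((Lc : ℝ) ^ (n + 1 + 1 + 1)) ^ (3 + 2) * GamΦ (N := Lc ^ (n + 1 + 1 + 1)) α x' l (legPt Lc (Sum.inl l) w i)) -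
          ((Lc : ℝ) ^ (n + 1 + 1)) ^ (3 + 2) * GamΦ (N := Lc ^ (n + 1 + 1)) α x' l w|
        ≤ c' * θ' ^ (n + 1) * Real.exp (-κ' * l1 (x' - quo (Lc ^ (n + 1 + 1)) w)))
    (n : ℕ) (x' w : Fin (3 + 1) → ℤ) (α l : Fin (3 + 1)) :
    |((Lc : ℝ) ^ (n + 1 + 1)) ^ (3 + 2) *
        unitK (Lc : ℝ) ((Lc : ℝ) ^ (3 + 1)) (dec Lc (KInv (N := Lc ^ (n + 1 + 1 + 1)) (d := 3)))
          (((Lc ^ (n + 1 + 1) : ℕ) : ℤ) • x') w (Sum.inr α) (Sum.inl l)| ≤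
      (CH + c') * Real.exp (-κ₀ * l1 (x' - quo (Lc ^ (n + 1 + 1)) w)) := by
  have hK := legK_mf (Lc := Lc) hκH hG n x' w α l
  have hD := legD_mf (Lc := Lc) hκ' hDG n x' w α l
  rw [mker_sub_apply', mul_sub] at hD
  exact abs_le_of_sub hK hD hc' (pow_le_one₀ hθ0 hθ1) (Real.exp_pos _).le

/-- [folklore] **THE `mm` ROW DIFFERENCE BLOCK `(K♮ − K)_{mm}` IS `Lc^8 ×` THE K-SLOT's ONE-STEP DIFFERENCE** `K̃_{n+2} − K̃_{n+1}` at the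
`Lc`-dilated points (or `0 − 0` off the coarse lattice): bound `Lc^8·cK·θ_K^{n+1}·e^{−κ₀|x′ − quo_N w|₁}` from `CauchyDecayK` at `(k, j) = (n+1, 1)`. -/
theorem legD_mm_left (hκ₀ : 0 ≤ κ₀) (hκ : κ₀ ≤ δK) (hcK : 0 ≤ cK) (hθK : 0 ≤ θK)
    (hKall : CauchyDecayK 3 Lc (sfStep Lc) (smStep 3 Lc) cK θK δK)
    (n : ℕ) (x' w : Fin (3 + 1) → ℤ) (α β : Fin (3 + 1)) :
    |((Lc : ℝ) ^ (n + 1 + 1)) ^ (2 * (3 + 1)) *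
        (unitK (Lc : ℝ) ((Lc : ℝ) ^ (3 + 1)) (dec Lc (KInv (N := Lc ^ (n + 1 + 1 + 1)) (d := 3))) -
          KInv (N := Lc ^ (n + 1 + 1)) (d := 3)) (((Lc ^ (n + 1 + 1) : ℕ) : ℤ) • x') w (Sum.inr α) (Sum.inr β)| ≤
      ((Lc : ℝ) ^ (2 * (3 + 1)) * cK) * θK ^ (n + 1) * Real.exp (-κ₀ * l1 (x' - quo (Lc ^ (n + 1 + 1)) w)) := by
  have hL8 : (0 : ℝ) ≤ (Lc : ℝ) ^ (2 * (3 + 1)) := by positivity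
  rw [mker_sub_apply', mul_sub, unitK_dec_mm_coarse_left (d := 3) (pow3_eq n), ← mul_assoc, pow_mm_succ]
  by_cases hw : Torus.proj (Lc ^ (n + 1 + 1)) w = 0
  · -- on the coarse lattice: both legs are K-slot unit resolvents at `Lc`-dilated points
    have ew : w = (((Lc ^ (n + 1 + 1) : ℕ) : ℤ)) • quo (Lc ^ (n + 1 + 1)) w := eq_zsmul_quo_of_proj hw
    set wb := quo (Lc ^ (n + 1 + 1)) w with hwb
    have eLw : (Lc : ℤ) • w = (((Lc ^ (n + 1 + 1 + 1) : ℕ) : ℤ)) • wb := by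
      rw [ew, zsmul_zsmul_eq, ← pow3_eq]
    rw [eLw]
    conv_lhs => rw [ew]
    rw [mm_coarse_eq_KStepUnit (d := 3) (n + 1 + 1) x' wb α β, mm_coarse_eq_KStepUnit (d := 3) (n + 1) x' wb α β, ← mul_sub,
      abs_mul, abs_of_nonneg hL8]
    have h := hKall (n + 1) 1 ((Lc : ℤ) • x') ((Lc : ℤ) • wb) (Sum.inr α) (Sum.inr β)
    rw [HessKerDressedLimit.mker_sub_apply] at h
    have hL1 : 1 ≤ Lc := Nat.one_le_iff_ne_zero.2 (NeZero.ne Lc)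
    have h2 : |KStepUnit (d := 3) Lc (n + 1 + 1) ((Lc : ℤ) • x') ((Lc : ℤ) • wb) (Sum.inr α) (Sum.inr β) -
        KStepUnit (d := 3) Lc (n + 1) ((Lc : ℤ) • x') ((Lc : ℤ) • wb) (Sum.inr α) (Sum.inr β)| ≤
        cK * θK ^ (n + 1) * Real.exp (-κ₀ * l1 (x' - wb)) := by
      refine h.trans ?_
      refine mul_le_mul_of_nonneg_left ?_ (by positivity)
      rw [Real.exp_le_exp]
      have := l1_sub_le_l1_smul_sub (d := 3) hL1 x' wb
      nlinarith [l1_nonneg (x' - wb)]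
    calc (Lc : ℝ) ^ (2 * (3 + 1)) * _ ≤ (Lc : ℝ) ^ (2 * (3 + 1)) * (cK * θK ^ (n + 1) * Real.exp (-κ₀ * l1 (x' - wb))) :=
          mul_le_mul_of_nonneg_left h2 hL8
      _ = _ := by ring
  · -- off the coarse lattice: both `mm` legs vanish
    have hw' : Torus.proj (Lc ^ (n + 1 + 1 + 1)) ((Lc : ℤ) • w) ≠ 0 := fun h => hw (proj_eq_zero_of_proj_zsmul (pow3_eq n) h)
    rw [KInv_inr_inr_of_proj_ne _ _ hw', KInv_inr_inr_of_proj_ne _ _ hw, mul_zero, mul_zero, sub_zero, abs_zero]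
    positivity

/-- [folklore] **THE `mm` COLUMN DIFFERENCE BLOCK** (right form): the same bound in `|quo_N y − z′|₁`. -/
theorem legD_mm_right (hκ₀ : 0 ≤ κ₀) (hκ : κ₀ ≤ δK) (hcK : 0 ≤ cK) (hθK : 0 ≤ θK)
    (hKall : CauchyDecayK 3 Lc (sfStep Lc) (smStep 3 Lc) cK θK δK)
    (n : ℕ) (y z' : Fin (3 + 1) → ℤ) (α β : Fin (3 + 1)) :
    |((Lc : ℝ) ^ (n + 1 + 1)) ^ (2 * (3 + 1)) *
        (unitK (Lc : ℝ) ((Lc : ℝ) ^ (3 + 1)) (dec Lc (KInv (N := Lc ^ (n + 1 + 1 + 1)) (d := 3))) -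
          KInv (N := Lc ^ (n + 1 + 1)) (d := 3)) y (((Lc ^ (n + 1 + 1) : ℕ) : ℤ) • z') (Sum.inr α) (Sum.inr β)| ≤
      ((Lc : ℝ) ^ (2 * (3 + 1)) * cK) * θK ^ (n + 1) * Real.exp (-κ₀ * l1 (quo (Lc ^ (n + 1 + 1)) y - z')) := by
  have hL8 : (0 : ℝ) ≤ (Lc : ℝ) ^ (2 * (3 + 1)) := by positivity
  rw [mker_sub_apply', mul_sub, unitK_dec_mm_coarse_right (d := 3) (pow3_eq n), ← mul_assoc, pow_mm_succ]
  by_cases hy : Torus.proj (Lc ^ (n + 1 + 1)) y = 0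
  · have ey : y = (((Lc ^ (n + 1 + 1) : ℕ) : ℤ)) • quo (Lc ^ (n + 1 + 1)) y := eq_zsmul_quo_of_proj hy
    set yb := quo (Lc ^ (n + 1 + 1)) y with hyb
    have eLy : (Lc : ℤ) • y = (((Lc ^ (n + 1 + 1 + 1) : ℕ) : ℤ)) • yb := by
      rw [ey, zsmul_zsmul_eq, ← pow3_eq]
    rw [eLy]
    conv_lhs => rw [ey]
    rw [mm_coarse_eq_KStepUnit (d := 3) (n + 1 + 1) yb z' α β, mm_coarse_eq_KStepUnit (d := 3) (n + 1) yb z' α β, ← mul_sub,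
      abs_mul, abs_of_nonneg hL8]
    have h := hKall (n + 1) 1 ((Lc : ℤ) • yb) ((Lc : ℤ) • z') (Sum.inr α) (Sum.inr β)
    rw [HessKerDressedLimit.mker_sub_apply] at h
    have hL1 : 1 ≤ Lc := Nat.one_le_iff_ne_zero.2 (NeZero.ne Lc)
    have h2 : |KStepUnit (d := 3) Lc (n + 1 + 1) ((Lc : ℤ) • yb) ((Lc : ℤ) • z') (Sum.inr α) (Sum.inr β) -
        KStepUnit (d := 3) Lc (n + 1) ((Lc : ℤ) • yb) ((Lc : ℤ) • z') (Sum.inr α) (Sum.inr β)| ≤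
        cK * θK ^ (n + 1) * Real.exp (-κ₀ * l1 (yb - z')) := by
      refine h.trans ?_
      refine mul_le_mul_of_nonneg_left ?_ (by positivity)
      rw [Real.exp_le_exp]
      have := l1_sub_le_l1_smul_sub (d := 3) hL1 yb z'
      nlinarith [l1_nonneg (yb - z')]
    calc (Lc : ℝ) ^ (2 * (3 + 1)) * _ ≤ (Lc : ℝ) ^ (2 * (3 + 1)) * (cK * θK ^ (n + 1) * Real.exp (-κ₀ * l1 (yb - z'))) :=
          mul_le_mul_of_nonneg_left h2 hL8
      _ = _ := by ring
  · have hy' : Torus.proj (Lc ^ (n + 1 + 1 + 1)) ((Lc : ℤ) • y) ≠ 0 := fun h => hy (proj_eq_zero_of_proj_zsmul (pow3_eq n) h)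
    rw [KInv_inr_inr_of_proj_ne_left _ _ hy', KInv_inr_inr_of_proj_ne_left _ _ hy, mul_zero, mul_zero, sub_zero, abs_zero]
    positivity

end LegsKn

end Summit.QuantumFields.BalabanUV.Beta.GAN24.S3DiffVLegs

end
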